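import Mathlib
import Literature.Barriers.ValiantsHypothesis.AlgebraicNaturalProofs
import Literature.Computability.AlgebraicComplexity.ApolarityAction
import Summits.ValiantsHypothesis.ValiantsHypothesis.Theorems.BarrierLeverSuccinctHittingSetsForVPLowSupport
import HarnessLib

/-!
# Crux `BarrierLever.SuccinctHittingSetsForVP` (stmt-ValiantsHypothesis-14610), line `registered` —
DISTINGUISHERS WITH A LOW-DIMENSIONAL SPACE OF PARTIAL DERIVATIVES ARE HIT (registered stub
`stub_lowPartialsHit`, conditional on the neighbour stub `stub_derivDimension` taken verbatim as a
hypothesis)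

**What is proved (it does NOT close the item).** The registered stub `stub_lowPartialsHit` of the
skeleton `Cruxes/SuccinctHittingSetsForVP/Lines/birth.lean` (wave 3): ASSUMING the dimension lemma
`stub_derivDimension` (a monomial `m` of `F` with inclusion-minimal support forces every
finite-dimensional space containing the iterated partials `∂^v F`, `v ≤ m`, to have dimension
`≥ 2^|supp m|`), if `t (2n + 2) ≤ n ^ b` then the coefficient vectors of `SmallCircuits ℂ n b` hit
every nonzero polynomial `D` in the `C(2n, n)` coefficient variables all of whose partial derivatives
`g ⌟ D` (`apolarAction g D`) lie in a space of dimension `< 2^(t+1)` — e.g. `ΣΛΣ` distinguishers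
(sums of few powers of affine forms).

* `LowPartialsHit.exists_support_minimal` : a nonzero polynomial has a monomial of minimal support
  CARDINALITY, which is then support-minimal under inclusion;
* `LowPartialsHit.le_of_pow_lt_pow_succ` : `2 ^ k ≤ d < 2 ^ (t + 1) ⟹ k ≤ t`;
* `stub_lowPartialsHit` (registered stub).

Proof: take a monomial `m` of `D` with the fewest variables (`Finset.exists_min_image`); by
cardinality it is support-minimal under inclusion (`Finset.eq_of_subset_of_card_le`), so the
hypothesis gives `2^|supp m| ≤ dim V < 2^(t+1)`, i.e. `|supp m| ≤ t`, and the landed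
`isSuccinctHittingSet_of_small_support` (`…LowSupport.lean`, p147275) hits `D`.
Axioms: `propext`, `Classical.choice`, `Quot.sound`. References: [ForbesShpilkaVolk2018] Def. 3,
Question 6 (framework); the argument is folklore (partial-derivative method).
-/

-- layout Summits/ValiantsHypothesis/ValiantsHypothesis forces the duplicated namespace component
set_option linter.dupNamespace false

namespace Summit.ValiantsHypothesis.ValiantsHypothesis.Theorems.BarrierLever.SuccinctHittingSetsForVP

open Literature.Barriers.ValiantsHypothesis Literature.Computability.AlgebraicComplexity MvPolynomial

namespace LowPartialsHit

/-- **A monomial with the fewest variables is support-minimal.** A nonzero polynomial (any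
coefficients, any variables) has a monomial `m` in its support such that no monomial of the support
has support strictly inside `supp m`. [folklore] -/
theorem exists_support_minimal {ι R : Type*} [CommSemiring R] {D : MvPolynomial ι R} (hD : D ≠ 0) :
    ∃ m ∈ D.support, ∀ u ∈ D.support, u.support ⊆ m.support → u.support = m.support := by
  obtain ⟨m, hm, hmin⟩ :=
    D.support.exists_min_image (fun m => m.support.card) (support_nonempty.mpr hD)
  exact ⟨m, hm, fun u hu hsub => Finset.eq_of_subset_of_card_le hsub (hmin u hu)⟩

/-- `2 ^ k ≤ d < 2 ^ (t + 1)` forces `k ≤ t`. [folklore] -/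
theorem le_of_pow_lt_pow_succ {k d t : ℕ} (hk : 2 ^ k ≤ d) (hd : d < 2 ^ (t + 1)) : k ≤ t :=
  Nat.lt_succ_iff.mp ((Nat.pow_lt_pow_iff_right (by norm_num)).mp (lt_of_le_of_lt hk hd))

end LowPartialsHit

/-- **Registered stub `stub_lowPartialsHit`** (crux stmt-ValiantsHypothesis-14610, line
`registered`; wave 3, CONDITIONAL on the neighbour stub `stub_derivDimension` verbatim): if
`t (2n + 2) ≤ n ^ b`, the coefficient vectors of `SmallCircuits ℂ n b` hit every nonzero `D` all of
whose partial derivatives `g ⌟ D` lie in a space of dimension `< 2^(t+1)` — a monomial of `D` with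
the fewest variables is support-minimal, so by the hypothesis `2^|supp| ≤ dim < 2^(t+1)`, whence
`|supp| ≤ t` and `isSuccinctHittingSet_of_small_support` applies.
[cite: ForbesShpilkaVolk2018, Def. 3 and Question 6] [folklore] -/
theorem stub_lowPartialsHit :
    (∀ (ι : Type) [DecidableEq ι] (F : MvPolynomial ι ℂ) (m : ι →₀ ℕ), m ∈ F.support →
      (∀ u ∈ F.support, u.support ⊆ m.support → u.support = m.support) →
      ∀ V : Submodule ℂ (MvPolynomial ι ℂ), FiniteDimensional ℂ V →
        (∀ v : ι →₀ ℕ, v ≤ m → apolarAction (monomial v (1 : ℂ)) F ∈ V) →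
        2 ^ m.support.card ≤ Module.finrank ℂ V) →
    ∀ n t b : ℕ, t * (2 * n + 2) ≤ n ^ b →
      IsSuccinctHittingSet (degLEMonomials n) (SmallCircuits ℂ n b)
        {D | ∃ V : Submodule ℂ (MvPolynomial (degLEMonomials n) ℂ), FiniteDimensional ℂ V ∧
          Module.finrank ℂ V < 2 ^ (t + 1) ∧ ∀ g, apolarAction g D ∈ V} := by
  intro hA n t b h D hD hD0
  obtain ⟨V, hVfd, hVdim, hVmem⟩ := hD
  obtain ⟨m, hm, hmin⟩ := LowPartialsHit.exists_support_minimal hD0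
  have hpow : 2 ^ m.support.card ≤ Module.finrank ℂ V :=
    hA (degLEMonomials n) D m hm hmin V hVfd fun v _ => hVmem _
  exact isSuccinctHittingSet_of_small_support h D
    ⟨m, hm, LowPartialsHit.le_of_pow_lt_pow_succ hpow hVdim⟩ hD0

end Summit.ValiantsHypothesis.ValiantsHypothesis.Theorems.BarrierLever.SuccinctHittingSetsForVP
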